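import Summits.HodgeConjecture.CorCM.IrreducibleOddWeightsRightIdealsHecke
import Summits.HodgeConjecture.CorCM.IrreducibleOddWeightsShadowIdealsCMFields
import HarnessLib

/-!
# Right ideals, IV: two CM fields over a common Galois pivot — the EXACT Hecke formula
# `dim Hg(A₀) + dim Hg(A₁) − dim Hg(A₀ × A₁) = dim(w₀ℚ[Gal(M/ℚ)] ∩ w₁ℚ[Gal(M/ℚ)])`

COR-CM (cell `pub-hodgecm2`, binder seat `b16` gen 64, count-neutral claim RIGHT IDEALS, file R4 — CM-field dress of R3/R3b
`IrreducibleOddWeightsRightIdeals{Pivot,Hecke}`; theorems only, no definition, no named fact, no `sorry`).  NEW as stated,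
hence under `Summits/`.  HONEST FRAMING: an exact formula for the codimension of the Hodge group of a product `A₀ × A₁` of
two abelian varieties with complex multiplication inside `Hg(A₀) × Hg(A₁)`, in terms of the two shadows on a common Galois
subfield; `HC_CM` is neither used nor asserted.

SETTING (gen 63 S5 `IrreducibleOddWeightsShadowIdealsCMFields`, whose notation is kept).  CM fields `K_{i₀}`, `K_{i₁}`
(`I = {i₀, i₁}`), CM types `Φ_κ`, a number field `M` GALOIS over `ℚ` with `j_κ : M → K_{i_κ}`, `z₀ : M → ℂ`; the SHADOWS
`w_κ(z) = Σ_{t | t∘j_κ = z} u_1(Φ_κ)(t) = 2·#{t ∈ Φ_κ : t|_M = z} − [K_κ:M]` on `Hom(M, ℂ)` and their HECKE TRANSLATES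
`w_κ(· ∘ δ)`, `δ ∈ Gal(M/ℚ)`, spanning `H_κ = w_κℚ[Gal(M/ℚ)] ≤ ℚ^{Hom(M,ℂ)}` (the right ideal generated by `w_κ` in the
group ring of the torsor).  S5 proved: if the Galois closures `L₀`, `L₁` meet inside `z₀(M)`, then
`Hg(A₀ × A₁) = Hg(A₀) × Hg(A₁)` iff `H₀ ∩ H₁ = 0`.

* **`cmTypeRank_add_cmTypeRank_eq_cmFamilyRank_add_one_add_finrank_inf`** — THE EXACT HECKE FORMULA: under the same
  hypothesis, **`cmTypeRank Φ₀ + cmTypeRank Φ₁ = cmFamilyRank Φ + 1 + dim(H₀ ∩ H₁)`**, i.e.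
  **`dim Hg(A₀) + dim Hg(A₁) − dim Hg(A₀ × A₁) = dim(w₀ℚ[Γ] ∩ w₁ℚ[Γ])`**, `Γ = Gal(M/ℚ)` — a rank computation on
  `2·|Γ|` integer vectors of length `|Γ|`.  (R3: the common matrix coefficients `MC₀ ∩ MC₁`, whose dimension IS the defect
  by R1, are right-invariant under `Aut(ℂ/z₀M) ⊆ ⟨Aut(ℂ/L₀), Aut(ℂ/L₁)⟩` and average into common fibre sums; R3b: fibre
  sums are the Hecke translates pulled back along `g ↦ g ∘ z₀`.)
* **`cmFamilyRank_add_one_add_finrank_inf_le`** — with NO hypothesis on the closures (any Galois `M` received by both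
  fields): `cmFamilyRank Φ + 1 + dim(H₀ ∩ H₁) ≤ cmTypeRank Φ₀ + cmTypeRank Φ₁` — every independent common Hecke combination
  of the shadows is an independent unit of the drop (S5 had: one non-zero common element ⟹ strict inequality).
* **`cmFamilyRank_add_card_eq_pair_iff_finrank_inf_eq_zero`** — S5's criterion as the case `dim(H₀ ∩ H₁) = 0`.

## References

* [Kubota1965] T. Kubota, *On the field extension by complex multiplication*, Trans. AMS 118 (1965), §2 Lemma 2, §4.
* [Gordon1999HodgeAVSurvey] B. B. Gordon, *A survey of the Hodge conjecture for abelian varieties*, §3 Theorem (proof),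
  7.5–7.7, 9.4.3.
* [Deligne1982HodgeCycles] P. Deligne, *Hodge cycles on abelian varieties*, LNM 900 (1982), I.5 (p. 53), I Ex. 3.7.
* [Lang2002] S. Lang, *Algebra*, VI §1 Thm. 1.14, V §2 Thm. 2.8.
* [Shimura1998] G. Shimura, *Abelian Varieties with Complex Multiplication and Modular Functions*, §8.1, §8.3.
-/

set_option autoImplicit false

noncomputable section

open scoped BigOperators Classical

open CategoryTheory CategoryTheory.Limits NumberField Module IntermediateField

namespace Summit.HodgeConjecture.CorCM

open Literature.NumberTheory.ComplexMultiplication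
open Literature.AlgebraicGeometry.Motives (AbelianVariety CMType)
open Literature.AlgebraicGeometry.Pohlmann1968

variable {I : Type} [Fintype I] {K : I → Type} [∀ i, Field (K i)] [∀ i, NumberField (K i)] [∀ i, IsCMField (K i)]
  {M : Type} [Field M] [NumberField M]

/-- **THE UNCONDITIONAL HALF**: for ANY Galois number field `M` received by both CM fields,
`cmFamilyRank Φ + 1 + dim(H₀ ∩ H₁) ≤ cmTypeRank Φ₀ + cmTypeRank Φ₁` — the drop `dim Hg(A₀) + dim Hg(A₁) − dim Hg(A₀ × A₁)`
is at least the dimension of the common Hecke combinations of the two shadows.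
[cite: Gordon1999HodgeAVSurvey, §3 Theorem (proof) and 7.5] [cite: Kubota1965, §4] [cite: Shimura1998, §8.1] -/
theorem cmFamilyRank_add_one_add_finrank_inf_le [IsGalois ℚ M] {i₀ i₁ : I} (h01 : i₀ ≠ i₁) (hI : ∀ l, l = i₀ ∨ l = i₁)
    (Φ : ∀ i, CMType (K i)) (j₀ : M →+* K i₀) (j₁ : M →+* K i₁) (z₀ : M →+* ℂ) :
    CMAlgebra.cmFamilyRank Φ + 1 +
        Module.finrank ℚ (Submodule.span ℚ (Set.range fun δ : M ≃ₐ[ℚ] M => fun z : M →+* ℂ =>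
            ∑ t ∈ Finset.univ.filter (fun t : K i₀ →+* ℂ => t.comp j₀ = z.comp (δ : M →+* M)),
              antiVec (Φ i₀).1 (1 : ℂ ≃+* ℂ) t) ⊓
          Submodule.span ℚ (Set.range fun δ : M ≃ₐ[ℚ] M => fun z : M →+* ℂ =>
            ∑ t ∈ Finset.univ.filter (fun t : K i₁ →+* ℂ => t.comp j₁ = z.comp (δ : M →+* M)),
              antiVec (Φ i₁).1 (1 : ℂ ≃+* ℂ) t) : Submodule ℚ ((M →+* ℂ) → ℚ)) ≤
      cmTypeRank (Φ i₀) + cmTypeRank (Φ i₁) := by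
  haveI : ∀ i, Nonempty (K i →+* ℂ) := fun i => inferInstance
  haveI := isPretransitive_ringEquiv_complex (K := M)
  exact IrrOdd.typeRank_sigmaType_add_one_add_finrank_inf_span_precomp_le (G := ℂ ≃+* ℂ) (E := fun i => K i →+* ℂ)
    (Φ := fun i => (Φ i).1) (fun i => isCMTypeWith_conj (Φ i)) hI h01 (fun t : K i₀ →+* ℂ => t.comp j₀)
    (fun t : K i₁ →+* ℂ => t.comp j₁) (fun _ _ => RingHom.ext fun _ => rfl) (fun _ _ => RingHom.ext fun _ => rfl)
    (fun (δ : M ≃ₐ[ℚ] M) (z : M →+* ℂ) => z.comp (δ : M →+* M)) (fun _ _ _ => RingHom.ext fun _ => rfl) z₀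
    (fun z => exists_comp_algEquiv_eq z z₀) (fun z => MulAction.exists_smul_eq (ℂ ≃+* ℂ) z₀ z)

/-- **THE EXACT HECKE FORMULA FOR TWO CM FIELDS OVER A COMMON GALOIS PIVOT.**  `I = {i₀, i₁}`; `M` Galois over `ℚ` with
`j_κ : M → K_{i_κ}`, `z₀ : M → ℂ`, and the Galois closures meeting inside `z₀(M)`.  Then
**`cmTypeRank Φ₀ + cmTypeRank Φ₁ = cmFamilyRank Φ + 1 + dim(H₀ ∩ H₁)`**, `H_κ = span{w_κ(· ∘ δ) : δ ∈ Gal(M/ℚ)}` the Hecke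
module (right ideal) of the shadow `w_κ(z) = 2·#{t ∈ Φ_κ | t∘j_κ = z} − [K_κ:M]` — i.e. **the codimension of `Hg(A₀ × A₁)`
in `Hg(A₀) × Hg(A₁)` is EXACTLY `dim(w₀ℚ[Γ] ∩ w₁ℚ[Γ])`**; gen 63's criterion (`…ShadowIdealsCMFields`) is its case `0`.
[cite: Kubota1965, §2 Lemma 2 and §4] [cite: Gordon1999HodgeAVSurvey, §3 Theorem (proof), 7.5–7.7 and 9.4.3]
[cite: Lang2002, VI §1 Thm. 1.14] [cite: Deligne1982HodgeCycles, I.5 (p. 53)] -/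
theorem cmTypeRank_add_cmTypeRank_eq_cmFamilyRank_add_one_add_finrank_inf [IsGalois ℚ M] {i₀ i₁ : I} (h01 : i₀ ≠ i₁)
    (hI : ∀ l, l = i₀ ∨ l = i₁) (Φ : ∀ i, CMType (K i)) (j₀ : M →+* K i₀) (j₁ : M →+* K i₁) (z₀ : M →+* ℂ)
    (hmeet : ∀ z : ℂ, z ∈ normalClosure ℚ (K i₀) ℂ → z ∈ normalClosure ℚ (K i₁) ℂ → z ∈ Set.range z₀) :
    cmTypeRank (Φ i₀) + cmTypeRank (Φ i₁) = CMAlgebra.cmFamilyRank Φ + 1 +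
      Module.finrank ℚ (Submodule.span ℚ (Set.range fun δ : M ≃ₐ[ℚ] M => fun z : M →+* ℂ =>
            ∑ t ∈ Finset.univ.filter (fun t : K i₀ →+* ℂ => t.comp j₀ = z.comp (δ : M →+* M)),
              antiVec (Φ i₀).1 (1 : ℂ ≃+* ℂ) t) ⊓
          Submodule.span ℚ (Set.range fun δ : M ≃ₐ[ℚ] M => fun z : M →+* ℂ =>
            ∑ t ∈ Finset.univ.filter (fun t : K i₁ →+* ℂ => t.comp j₁ = z.comp (δ : M →+* M)),
              antiVec (Φ i₁).1 (1 : ℂ ≃+* ℂ) t) : Submodule ℚ ((M →+* ℂ) → ℚ)) := by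
  haveI : ∀ i, Nonempty (K i →+* ℂ) := fun i => inferInstance
  haveI := isPretransitive_ringEquiv_complex (K := M)
  refine IrrOdd.typeRank_add_typeRank_eq_finrank_inf_span_precomp_of_pivot (G := ℂ ≃+* ℂ) (E := fun i => K i →+* ℂ)
    (Φ := fun i => (Φ i).1) (fun i => isCMTypeWith_conj (Φ i)) hI h01 (fun t : K i₀ →+* ℂ => t.comp j₀)
    (fun t : K i₁ →+* ℂ => t.comp j₁) (fun _ _ => RingHom.ext fun _ => rfl) (fun _ _ => RingHom.ext fun _ => rfl)
    (Subgroup.closure {g : ℂ ≃+* ℂ | ∀ m : M, g (z₀ m) = z₀ m}) (fun x x' hxx' => ?_) (fun x x' hxx' => ?_) ?_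
    (fun (δ : M ≃ₐ[ℚ] M) (z : M →+* ℂ) => z.comp (δ : M →+* M)) (fun _ _ _ => RingHom.ext fun _ => rfl) z₀
    (fun z => exists_comp_algEquiv_eq z z₀) (fun z => MulAction.exists_smul_eq (ℂ ≃+* ℂ) z₀ z)
  · obtain ⟨g, hg, hgx⟩ := exists_smul_eq_of_comp_eq j₀ z₀ hxx'.symm
    exact ⟨g, Subgroup.subset_closure hg, hgx⟩
  · obtain ⟨g, hg, hgx⟩ := exists_smul_eq_of_comp_eq j₁ z₀ hxx'.symm
    exact ⟨g, Subgroup.subset_closure hg, hgx⟩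
  · exact (Subgroup.closure_le _).2 fun g hg => mem_closure_fixing_of_normalClosure_inf_le z₀ hmeet hg

/-- **Gen 63's criterion as the case `dim = 0`**: under the same hypotheses `Hg(A₀ × A₁) = Hg(A₀) × Hg(A₁)`
(`cmFamilyRank Φ + 2 = cmTypeRank Φ₀ + cmTypeRank Φ₁ + 1`) iff `dim(H₀ ∩ H₁) = 0`.
[cite: Kubota1965, §2 Lemma 2 and §4] [cite: Gordon1999HodgeAVSurvey, §3 Theorem (proof) and 7.5–7.7] -/
theorem cmFamilyRank_add_card_eq_pair_iff_finrank_inf_eq_zero [IsGalois ℚ M] {i₀ i₁ : I} (h01 : i₀ ≠ i₁)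
    (hI : ∀ l, l = i₀ ∨ l = i₁) (Φ : ∀ i, CMType (K i)) (j₀ : M →+* K i₀) (j₁ : M →+* K i₁) (z₀ : M →+* ℂ)
    (hmeet : ∀ z : ℂ, z ∈ normalClosure ℚ (K i₀) ℂ → z ∈ normalClosure ℚ (K i₁) ℂ → z ∈ Set.range z₀) :
    CMAlgebra.cmFamilyRank Φ + Fintype.card I = (∑ i, cmTypeRank (Φ i)) + 1 ↔
      Module.finrank ℚ (Submodule.span ℚ (Set.range fun δ : M ≃ₐ[ℚ] M => fun z : M →+* ℂ =>
            ∑ t ∈ Finset.univ.filter (fun t : K i₀ →+* ℂ => t.comp j₀ = z.comp (δ : M →+* M)),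
              antiVec (Φ i₀).1 (1 : ℂ ≃+* ℂ) t) ⊓
          Submodule.span ℚ (Set.range fun δ : M ≃ₐ[ℚ] M => fun z : M →+* ℂ =>
            ∑ t ∈ Finset.univ.filter (fun t : K i₁ →+* ℂ => t.comp j₁ = z.comp (δ : M →+* M)),
              antiVec (Φ i₁).1 (1 : ℂ ≃+* ℂ) t) : Submodule ℚ ((M →+* ℂ) → ℚ)) = 0 := by
  have hpair := cmTypeRank_add_cmTypeRank_eq_cmFamilyRank_add_one_add_finrank_inf h01 hI Φ j₀ j₁ z₀ hmeet
  have hcard : Fintype.card I = 2 := by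
    rw [← Finset.card_univ, show (Finset.univ : Finset I) = {i₀, i₁} from Finset.ext fun j => by
      simpa only [Finset.mem_univ, Finset.mem_insert, Finset.mem_singleton, true_iff] using hI j,
      Finset.card_pair h01]
  rw [IrrOdd.sum_eq_add_of_pair _ hI h01, hcard]
  omega

end Summit.HodgeConjecture.CorCM

end
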